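import Summits.BirchSwinnertonDyer.Rank1Residual.X1.DoubleTwistDisplayKit
import Summits.BirchSwinnertonDyer.Rank1Residual.X2.RouteGThreeTorsionCount
import Summits.BirchSwinnertonDyer.Rank1Residual.Partition.EisensteinKernelCertificate
import Summits.BirchSwinnertonDyer.Rank1Residual.X2.CongruentPartnerAnomalous
import Summits.BirchSwinnertonDyer.Rank1Residual.X11b.ChaPairsMinimality
import Summits.BirchSwinnertonDyer.Rank1Residual.X11b.KrausMinimalityTwoUnit
import Summits.BirchSwinnertonDyer.BirchSwinnertonDyer.Theorems.Rank1ResidualIntModelReduction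
import Summits.BirchSwinnertonDyer.BirchSwinnertonDyer.Theorems.Rank1ResidualX11RankOneReduction
import Summits.BirchSwinnertonDyer.Rank1Residual.Additive.X3LineDatumFiveRecordsPrototype
import Literature.NumberTheory.EllipticCurves.Rank1Residual.X1ThreeDescentCertificate
import HarnessLib

/-!
# Row A2 (X1b: good anomalous Eisenstein prime, parity type B, `r_an = 1`) per pair, PREPRINT-FREE and SCHNEIDER-FREE descent road — display
# `726e1 @ 5`: `BSD(726e1, 5)` from Gross–Zagier–Kolyvagin alone + the two READS (`#Ш_an` a `5`-adic unit, `Ш[5] = 0` by the two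
# `5`-isogeny-descent engines), through the Literature door `X1.bsdp_of_noPTorsion` (cell `bsd-eis`, seat `bsd-eis-k5-p4` g0;
# RULING L84 (3) G2 display; THEOREMS ONLY — nothing booked; row A2 stays as booked class-wide)

HONEST FRAMING (FULL-BSD rank-≤1 programme D-0033, cell `bsd-eis`, run/shared/lean/pub/bsd-eis/; ladder row A2 = X1b: good anomalous Eisenstein prime, parity type B:
`p` good, anomalous, `E[p]` reducible, `r_an = 1`; 1 307 cells; class-wide road of record = Keller–Yin Thm D [PRE]; the GV-type-B + Schneider-C1 road of record where referee A has it).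
This file is a twin of `EisensteinPrimesA1Descent1690h1.lean` (p545679): the Literature door `X1.bsdp_of_noPTorsion`
(`Rank1Residual/X1ThreeDescentCertificate.lean`, b2b prover B gen 5: `r_an ≤ 1 → ClassX1 W p → ord_p #Ш_an = 0 → Ш(W)[p] = 0 → BSDp W p`,
named fact Gross–Zagier–Kolyvagin ONLY — no Keller–Yin, no Schneider certificate, no Iwasawa theory, no parity type) instantiated at the
window cell `726e @5` (`N < 10⁴`) of the class-wide table `pub/bsd-eis/k5-p4-g0/a1a2/A1A2-DESC3R1-TABLE-v1.tsv` 505ef047eb96068b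
(kit j282526/j283065/j283686): record `726e1 = [1, 0, 1, -5448, -113258]` (`N = 726 = 2·3·11²`, `5 ∤ N`), 5-isogeny kernel ``x² + 266x + 13333``,
`(s_φ̂, s_φ, m, EXCESS) = `(1, 0, 1, 0)`` identical on `isogchi` 42175383 ‖ `isogcft` 0e36e3a0 (`mw = 1`, `bnfcertify = 1`);
`#Ш_an = 1` on every member (Cremona `allbsd` = PARI leg), `r_an = 1` (Cremona; PARI `ellanalyticrank`). All four members `726e1–e4` carry EXCESS `0` on both engines (kernels `x² + 266x + 13333`, `x² + 156x − 3717`, `x² − 1329x + 2204141/5`, `x² − 779x + 315661/5`).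
**IN THE KERNEL here:** `726e1` elliptic, globally minimal (bounded Kraus criterion), GOOD ANOMALOUS at `5` (`5 ∤ Δ = 4849031734272`,
`#Ẽ(𝔽_5) = 10`, `a_5 = (-4) ≡ 1 (mod 5)`), `E[5]` reducible (kernel polynomial `h = x² + 266x + 13333` of the rational `5`-isogeny: `h ∣ preΨ'₅`, doubling closure, `⟨2⟩ = 𝔽₅ˣ` — `Additive.KernelPolyLine.exists_isRationalLine_of_kernelPolyCert`, k5-c4 g8's road); `ClassX1 726e1 5` then follows GIVEN
`r_an = 1` (the class's last clause `¬(r_an = 0 ∧ GVPar)` is vacuous in rank one — no parity-type certificate is needed on this road,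
which is why the same door serves type A and type B alike).
**READ (hypotheses):** `hr : r_an = 1`, `hq`/`hv` : `#Ш_an = q`, `ord_5 q = 0`, `h : Ш[5] = 0`. **PUBLISHED fact BY NAME:** `hGZK` only.
Refs: [Miller2011LMS] Def. 1.1; [SilvermanAEC2009] VII.1 Rem. 1.1, VII.5 Prop. 5.1(a), Ex. 3.7, X.4.2; [Kraus1989] Prop. 1–2; Cremona `ecdata` class 726e.
-/

set_option autoImplicit false
set_option linter.dupNamespace false

noncomputable section

open scoped Classical

open WeierstrassCurve NumberField IsDedekindDomain Field Polynomial
  Literature.NumberTheory.EllipticCurves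
  Literature.NumberTheory.EllipticCurves.ModularForms
  Literature.NumberTheory.EllipticCurves.Rank1Residual
  Summit.BirchSwinnertonDyer.BirchSwinnertonDyer.Rank1Residual.IntModel
  Summit.BirchSwinnertonDyer.BirchSwinnertonDyer.Rank1Residual.X11RankOne
  Summit.BirchSwinnertonDyer.Rank1Residual.X11b
  Summit.BirchSwinnertonDyer.Rank1Residual.X2
  Summit.BirchSwinnertonDyer.Rank1Residual.Additive
  Summit.BirchSwinnertonDyer.Rank1Residual

namespace Summit.BirchSwinnertonDyer.BirchSwinnertonDyer.Theorems.A2Descent726e1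

/-- `726e1 = [1, 0, 1, -5448, -113258]` is elliptic (`Δ = 4849031734272 ≠ 0`). [folklore] -/
theorem isElliptic_726e1 : (⟨1, 0, 1, (-5448), (-113258)⟩ : WeierstrassCurve ℚ).IsElliptic :=
  isElliptic_of_discOf_ne_zero 1 0 1 (-5448) (-113258) (by decide +kernel)

set_option maxRecDepth 100000 in
/-- `726e1` is globally minimal (bounded Kraus criterion; `|Δ| = 2¹⁰·3⁵·11⁷ < 512¹²`). [cite: SilvermanAEC2009, VII.1 Remark 1.1]
[cite: Kraus1989, Prop. 1 and Prop. 2] -/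
theorem isGloballyMinimal_726e1 : (⟨1, 0, 1, (-5448), (-113258)⟩ : WeierstrassCurve ℚ).IsGloballyMinimal :=
  isGloballyMinimal_of_krausCriterion_bounded₃ 1 0 1 (-5448) (-113258)
    (by decide +kernel) (by decide +kernel) (by decide +kernel)

/-- **`726e1` has GOOD, ANOMALOUS reduction at `5`**: `5 ∤ Δ` and `a_5 = (-4)` (`#Ẽ(𝔽_5) = 10`), so `5 ∣ a_5 − 1`.
[cite: SilvermanAEC2009, VII.5 Prop. 5.1(a)] -/
theorem good_frobeniusTrace_726e1 [(⟨1, 0, 1, (-5448), (-113258)⟩ : WeierstrassCurve ℚ).IsGloballyMinimal] :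
    (⟨1, 0, 1, (-5448), (-113258)⟩ : WeierstrassCurve ℚ).HasGoodReductionAtPrime 5 ∧
      (⟨1, 0, 1, (-5448), (-113258)⟩ : WeierstrassCurve ℚ).frobeniusTrace 5 = (-4) := by
  have hI := integralModelInt_eq_of_map_eq (W := (⟨1, 0, 1, (-5448), (-113258)⟩ : WeierstrassCurve ℚ)) _ (map_mk_int 1 0 1 (-5448) (-113258))
  have hcard : Nat.card (((⟨1, 0, 1, (-5448), (-113258)⟩ : WeierstrassCurve ℤ).map (Int.castRingHom (ZMod 5))).toAffine.Point) = 10 := by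
    rw [@WeierstrassCurve.natCard_point_eq_one_add_card (ZMod 5) (@ZMod.instField 5 ⟨by norm_num⟩) _ _ _
      (by decide +kernel), @card_sol_eq_sum_euler (ZMod 5) (@ZMod.instField 5 ⟨by norm_num⟩) _ _
      (by rw [ZMod.ringChar_zmod_n]; decide), ZMod.card]
    decide +kernel
  refine ⟨hasGoodReductionAtPrime_of_not_dvd _ 5 (by rw [minimalDiscriminantInt, hI, intCurve_Δ]; decide +kernel), ?_⟩
  rw [frobeniusTrace_eq hI hcard]
  decide

/-! ## The Galois side at `5`: `726e1[5]` is reducible (kernel-polynomial certificate, k5-c4 g8's road) -/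

/-- (c1) for `726e1` at `5`: `preΨ'₅ = h · q` with the kernel polynomial `h = x² + 266x + 13333` of the
rational `5`-isogeny inside class `726e`. [folklore] -/
theorem preΨ'_five_726e1 :
    (⟨1, 0, 1, (-5448), (-113258)⟩ : WeierstrassCurve ℚ).preΨ' 5 = (X ^ 2 + C 266 * X + C 13333) *
      (C 3819064632424657841 + C 295397259235579903 * X + C 5029071738391717 * X ^ 2 + C (-59065217221840) * X ^ 3 + C 2600250668086 * X ^ 4 + C 129003714230 * X ^ 5 + C 646036198 * X ^ 6 + C (-11659576) * X ^ 7 + C (-51959) * X ^ 8 + C (-1325) * X ^ 9 + C 5 * X ^ 10) := by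
  rw [show (5 : ℕ) = 2 * (0 + 2) + 1 from rfl, preΨ'_odd]
  rw [if_pos (by decide : Even (0 : ℕ)), if_pos (by decide : Even (0 : ℕ))]
  simp only [zero_add, preΨ'_four, preΨ'_two, preΨ'_one, preΨ'_three, one_pow, mul_one]
  apply Polynomial.funext
  intro r
  simp only [preΨ₄, Ψ₃, Ψ₂Sq, b₂, b₄, b₆, b₈, eval_add, eval_sub, eval_mul, eval_pow, eval_C,
    eval_X, eval_ofNat, eval_one, eval_neg, map_neg]
  ring

/-- (c2) for `726e1` at `5`: the doubling-closure identity `∑_{i ≤ 2} h_i Φ₂^i Ψ₂Sq^{2−i} = h · q₂`.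
[folklore] -/
theorem dbl_726e1 :
    ∑ i ∈ Finset.range (2 + 1), C ((X ^ 2 + C 266 * X + C 13333 : ℚ[X]).coeff i) *
        (⟨1, 0, 1, (-5448), (-113258)⟩ : WeierstrassCurve ℚ).Φ 2 ^ i *
        (⟨1, 0, 1, (-5448), (-113258)⟩ : WeierstrassCurve ℚ).Ψ₂Sq ^ (2 - i) =
      (X ^ 2 + C 266 * X + C 13333) *
        (C 2556037705 + C 2601865998 * X + C 40292223 * X ^ 2 + C (-5527084) * X ^ 3 + C 9783 * X ^ 4 + C 798 * X ^ 5 + C 1 * X ^ 6) := by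
  have hc0 : ((X ^ 2 + C 266 * X + C 13333 : ℚ[X])).coeff 0 = 13333 := by
    simp
  have hc1 : ((X ^ 2 + C 266 * X + C 13333 : ℚ[X])).coeff 1 = 266 := by
    simp
  have hc2 : ((X ^ 2 + C 266 * X + C 13333 : ℚ[X])).coeff 2 = 1 := by
    simp
  simp only [Finset.sum_range_succ, Finset.sum_range_zero, zero_add, hc0, hc1, hc2, pow_zero, pow_one,
    Nat.sub_zero, Nat.sub_self, show 2 - 1 = 1 from rfl, mul_one, one_mul, map_one]
  apply Polynomial.funext
  intro r
  simp only [Φ_two, Ψ₂Sq, b₂, b₄, b₆, b₈, eval_add, eval_sub, eval_mul, eval_pow, eval_C, eval_X,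
    map_neg, eval_neg]
  ring

/-- **`726e1[5]` contains a RATIONAL `5`-LINE** whose non-zero points lie above the roots of `h`
(`Additive.KernelPolyLine.exists_isRationalLine_of_kernelPolyCert` with (c1), (c2) and `2` generating
`𝔽₅ˣ`). [cite: SilvermanAEC2009, Ex. 3.7 (b),(d),(f) and III.2.3] -/
theorem exists_isRationalLine_726e1 :
    ∃ Φ : AddSubgroup (geomTorsion (⟨1, 0, 1, (-5448), (-113258)⟩ : WeierstrassCurve ℚ) ((5 : ℕ) : ℤ)),
      IsRationalLine ⟨1, 0, 1, (-5448), (-113258)⟩ 5 Φ ∧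
      ∀ Q ∈ Φ, Q ≠ 0 → ∃ (x y : AlgebraicClosure ℚ)
        (hxy : ((⟨1, 0, 1, (-5448), (-113258)⟩ : WeierstrassCurve ℚ).baseChange
          (AlgebraicClosure ℚ)).toAffine.Nonsingular x y),
        (Q : (⟨1, 0, 1, (-5448), (-113258)⟩ : WeierstrassCurve ℚ).geomPoints) = Affine.Point.some x y hxy ∧
          ((X ^ 2 + C 266 * X + C 13333 : ℚ[X]).map (algebraMap ℚ (AlgebraicClosure ℚ))).eval x = 0 := by
  haveI := isElliptic_726e1
  have e : (X ^ 2 + C 266 * X + C 13333 : ℚ[X]) = C 1 * X ^ 2 + C 266 * X + C 13333 := by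
    rw [map_one, one_mul]
  have hdeg : (X ^ 2 + C 266 * X + C 13333 : ℚ[X]).natDegree ≤ 2 := by
    rw [e]; exact natDegree_quadratic_le
  have hdeg2 : (X ^ 2 + C 266 * X + C 13333 : ℚ[X]).natDegree = 2 := by
    rw [e]; exact natDegree_quadratic one_ne_zero
  refine KernelPolyLine.exists_isRationalLine_of_kernelPolyCert (by norm_num) (m := 2) rfl hdeg preΨ'_five_726e1
    dbl_726e1 KernelPolyLineRecords.gen_five ?_
  have hne : (X ^ 2 + C 266 * X + C 13333 : ℚ[X]) ≠ 0 :=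
    ne_zero_of_natDegree_gt (n := 1) (by rw [hdeg2]; norm_num)
  have hd : ((X ^ 2 + C 266 * X + C 13333 : ℚ[X]).map (algebraMap ℚ (AlgebraicClosure ℚ))).degree ≠ 0 := by
    rw [degree_map, degree_eq_natDegree hne, hdeg2]
    norm_num
  obtain ⟨α, hα⟩ := IsAlgClosed.exists_root _ hd
  exact ⟨α, hα⟩

/-- **`726e1[5]` is reducible — IN THE KERNEL** (the rational `5`-line of `exists_isRationalLine_726e1`).
[folklore] -/
theorem not_irreducible_726e1 : ¬ (⟨1, 0, 1, (-5448), (-113258)⟩ : WeierstrassCurve ℚ).HasIrreducibleModPGaloisRep 5 := by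
  haveI := isElliptic_726e1
  obtain ⟨Φ, hΦ, -⟩ := exists_isRationalLine_726e1
  exact CongruentPartnerAnomalous.not_hasIrreducibleModPGaloisRep_of_isRationalLine hΦ

/-- **`ClassX1 726e1 5` GIVEN analytic rank one** (`5 > 2`; reducible; good; anomalous `5 ∣ a_5 − 1`; the parity clause
`¬(r_an = 0 ∧ GVPar)` is vacuous when `r_an = 1`). [cite: SilvermanAEC2009, VII.5 Prop. 5.1, Ex. 3.7] -/
theorem classX1_726e1 [(⟨1, 0, 1, (-5448), (-113258)⟩ : WeierstrassCurve ℚ).IsElliptic] [(⟨1, 0, 1, (-5448), (-113258)⟩ : WeierstrassCurve ℚ).IsGloballyMinimal]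
    (hr : (⟨1, 0, 1, (-5448), (-113258)⟩ : WeierstrassCurve ℚ).analyticRank = 1) : ClassX1 (⟨1, 0, 1, (-5448), (-113258)⟩ : WeierstrassCurve ℚ) 5 := by
  obtain ⟨hgood, ha⟩ := good_frobeniusTrace_726e1
  have han : ((5 : ℕ) : ℤ) ∣ (⟨1, 0, 1, (-5448), (-113258)⟩ : WeierstrassCurve ℚ).frobeniusTrace 5 - 1 := by
    rw [ha]; decide
  exact ⟨by norm_num, not_irreducible_726e1, hgood, ⟨not_irreducible_726e1, hgood, han⟩, fun h' ↦ by omega⟩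

/-- **X1b INSTANCE, DESCENT ROAD — `BSD(726e1, 5)`** from Gross–Zagier–Kolyvagin (`hGZK`) and the two READS on `726e1` (`#Ш_an` a
`5`-adic unit; `Ш[5] = 0` by the two isogeny-descent engines), through the Literature door `X1.bsdp_of_noPTorsion`; `ClassX1` in the kernel
given the READ `hr`. No Keller–Yin input, no Schneider certificate, no parity type. Nothing booked; `BSDp` only. [cite: Miller2011LMS, §1 and Def. 1.1] -/
theorem bsdp_726e1_at_five_of_descent (hGZK : rank_eq_analyticRank_of_analyticRank_le_one)
    (W : WeierstrassCurve ℚ) [W.IsElliptic] [W.IsGloballyMinimal] (hW : W = ⟨1, 0, 1, (-5448), (-113258)⟩)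
    (hr : W.analyticRank = 1) {q : ℚ} (hq : shaAn W = (q : ℂ)) (hv : padicValRat 5 q = 0)
    (h : ∀ x : W.sha, (5 : ℤ) • x = 0 → x = 0) : BSDp W 5 := by
  subst hW
  exact X1.bsdp_of_noPTorsion hGZK _ 5 (by omega) (classX1_726e1 hr) hq hv h

/-- **The same on the row's shape `ClassX1 W 5 → r_an = 1 → BSDp W 5`** modulo GZK and the two reads. [cite: Miller2011LMS, §1 and Def. 1.1] -/
theorem classX1_rankOne_bsdp_726e1_of_descent (hGZK : rank_eq_analyticRank_of_analyticRank_le_one)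
    (W : WeierstrassCurve ℚ) [W.IsElliptic] [W.IsGloballyMinimal] (hW : W = ⟨1, 0, 1, (-5448), (-113258)⟩)
    {q : ℚ} (hq : shaAn W = (q : ℂ)) (hv : padicValRat 5 q = 0) (h : ∀ x : W.sha, (5 : ℤ) • x = 0 → x = 0) :
    ClassX1 W 5 → W.analyticRank = 1 → BSDp W 5 :=
  fun _ hr ↦ bsdp_726e1_at_five_of_descent hGZK W hW hr hq hv h

end Summit.BirchSwinnertonDyer.BirchSwinnertonDyer.Theorems.A2Descent726e1

end
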